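import Summits.ResolutionOfSingularities.ResolutionOfSingularities.Theorems.WeightedInvariantJOpenPresentationDivisorial
import Summits.ResolutionOfSingularities.ResolutionOfSingularities.Theorems.WeightedInvariantJOpenPresentationCurve
import Summits.ResolutionOfSingularities.ResolutionOfSingularities.Theorems.WeightedInvariantJFlatEssSmoothAssembly
import Summits.ResolutionOfSingularities.ResolutionOfSingularities.Theorems.WeightedInvariantHypersurfaceLocalGameEFT4SDimLETwoDimOne
import Literature.AlgebraicGeometry.Resolution.StrictNormalCrossingsAt
import HarnessLib

/-!
# (open″)≤3 for the pair of record `(ι₃ᵗ, J₃ᵗ) = (Iota3.iotaFlatT, Iota3.jFlatT)` — THE REGIME ASSEMBLY, PART 1: the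
# height-two regime from a presenting pair (the `c = 2` branch) and bookkeeping
# (door `HypersurfaceCentreConstruction`, stmt-ResolutionOfSingularities-19897; P3 rung clause h8; DEAL (o52) SPLIT of
# res-L1-w43-plan-1 2026-08-27T15:54:33Z, part (o52-asm), hand res-D-brk-1)

Topic: `Summits/ResolutionOfSingularities/ResolutionOfSingularities/Theorems`. Helper for the door item
`HypersurfaceCentreConstruction` (stmt-ResolutionOfSingularities-19897, route `WeightedInvariant`), line `local-engine`
(L W4.3), def-free.  THE ASSEMBLY THEOREM `jOpenPresentationForallSingLE_three_of_bodies`: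

    (T) → (P₀₀) → (P₀₁) → (P₁₀) → JOpenPresentationForallSingLE 3 p iotaFlatT jFlatT,

with the four inputs SPELLED OUT (their named forms `JOpenLE3.TieFreeAlongCurveLE3 p`, `JOpenLE3.PointBodyLE3 p e t` live in the
definition module `…JOpenPresentationLE3Defs`, res-D-brk-1, review-queued at the time of filing; the named corollary follows it):
(T) along a height-two equimultiple stratum `V(𝔭)` through a non-tie position some `D(h) ∋ 𝔪` carries no tie prime `𝔮 ⊇ 𝔭` of local
dimension `≤ 3`; (P_{e,t}) the literal body at every position of dimension `3` whose top `ι₀`-stratum is the closed point, with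
`(ε, τ) = (e, t) ∈ {(0,0) ISOLATED, (0,1) TIE, (1,0) CROSSING}`.

At a model position `(A, 𝔪, F)` (`k₀` perfect of characteristic `p`, `A` of finite type, `S := A_𝔪` regular of dimension `≤ 3`,
`0 ≠ f := F/1 ∈ 𝔪_S²`) let `P₀ := topStratumPrime iotaOrdEpsTau S f` (prime, `S ⧸ P₀` regular: res-type-013's
`topStratumPrime_iotaOrdEpsTau_spec`) and choose generators `u : Fin c → S` of `P₀` with independent differentials (Literature
`exists_span_eq_of_isRegularLocalRing_quotient`), so `c = ht P₀`:
* `c = 1` — MONOMIAL TYPE (the order is kept at the height-one prime `P₀ ∋ f`: tree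
  `exists_eq_unit_mul_pow_of_iotaOrd_localization_eq_of_height_eq_one`) ⇒ res-D-brk-1's `jOpenPresentationLE_body_monomial` (p551867);
* `c = 2` — CURVE TYPE: `P₀ = (u₀, u₁)`; LEMMA M (res-L1-w43-stub-3) ⇒ `f` not of monomial type at `S_{P₀}`; the valuation dichotomy of
  `S ⧸ P₀` (a field or a discrete valuation ring) and res-D-brk-1's MAXIMISER DESCENT core `Descent.exists_pair_reaches` ⇒ a regular
  pair `(x', g')` of `S` generating `P₀` with `g'` reaching `b_max` at `S_{P₀}`; numerators `x, g ∈ A`; transport to `A_𝔭`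
  (`𝔭 = P₀ ∩ A`, `(A_𝔪)_{P₀} ≃ A_𝔭`); the ORDER form of the regime (off tie and crossing positions the top `ι₀`-stratum is the
  equimultiple locus); then res-D-brk-1's `jOpenPresentationLE_body_curve` (p552753) with (T);
* `c = 3` — POINT TYPE: `P₀ = 𝔪_S`, `dim S = 3`; by `(ε, τ) ∈ {(0,0), (0,1), (1,0)}` the inputs (P); `(1,1)` is vacuous.

[OURS · L1 W4.3 · (o52-asm)]  Replaces the role of NO printed item; NOT a statement of the manuscript
[claim: Hironaka2017, status: under-review]. AI work, weaker than expert review.  Pure commutative algebra; no named facts.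

## References

* H. Matsumura, *Commutative Ring Theory* (1987), Thm. 14.2 / 14.3 (regular parameters), Thm. 4.3 (primes of a localisation).
  [Matsumura1987]
* res-L1-w43-plan-1, IOTA3-DESIGN v1.3 §8.4 and DEAL (o52) SPLIT (OURS, AI planning).
-/

noncomputable section

open IsLocalRing Literature.AlgebraicGeometry.Resolution
open Summit.ResolutionOfSingularities.ResolutionOfSingularities.Cruxes.HypersurfaceCentreConstruction.LocalEngine
open Summit.ResolutionOfSingularities.ResolutionOfSingularities.Cruxes.HypersurfaceCentreConstruction.LocalEngine.Iota3

set_option linter.dupNamespace false -- mandated namespace of this single-conjunct summit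

namespace Summit.ResolutionOfSingularities.ResolutionOfSingularities.Theorems

namespace JOpenLE3

open ContactCylinder

/-! ## Bookkeeping -/

/-- The body with the dimension guard written `≤ 3` gives the body with the clause's guard `≤ (3 : ℕ)`. [folklore] -/
theorem jOpenBodyLE3_of_three {A : Type} [CommRing A] (𝔪 : Ideal A) [𝔪.IsPrime] (F : A)
    (h : ∃ h : A, h ∉ 𝔪 ∧ ∃ (N : ℕ) (U : Fin N → A) (W : Fin N → ℕ), (∀ i, 0 < W i) ∧
      (∃ hU : ∀ i, algebraMap A (Localization.AtPrime 𝔪) (U i) ∈ maximalIdeal (Localization.AtPrime 𝔪),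
        LinearIndependent (ResidueField (Localization.AtPrime 𝔪))
          (fun i => ((maximalIdeal (Localization.AtPrime 𝔪)).toCotangent ⟨_, hU i⟩ :
            CotangentSpace (Localization.AtPrime 𝔪)))) ∧
      ∀ (𝔮 : Ideal A) [𝔮.IsPrime], h ∉ 𝔮 → ringKrullDim (Localization.AtPrime 𝔮) ≤ 3 →
        ((∀ i, U i ∈ 𝔮) ↔
          (algebraMap A (Localization.AtPrime 𝔮) F ∈ (maximalIdeal (Localization.AtPrime 𝔮)) ^ 2 ∧
            iotaFlatT (Localization.AtPrime 𝔮) (algebraMap A (Localization.AtPrime 𝔮) F) =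
              iotaFlatT (Localization.AtPrime 𝔪) (algebraMap A (Localization.AtPrime 𝔪) F))) ∧
        ((∀ i, U i ∈ 𝔮) → ∀ m : ℕ,
          jFlatT (Localization.AtPrime 𝔮) (algebraMap A (Localization.AtPrime 𝔮) F) m =
            (weightedMonomialIdeal U W m).map (algebraMap A (Localization.AtPrime 𝔮)))) :
    ∃ h : A, h ∉ 𝔪 ∧ ∃ (N : ℕ) (U : Fin N → A) (W : Fin N → ℕ), (∀ i, 0 < W i) ∧
      (∃ hU : ∀ i, algebraMap A (Localization.AtPrime 𝔪) (U i) ∈ maximalIdeal (Localization.AtPrime 𝔪),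
        LinearIndependent (ResidueField (Localization.AtPrime 𝔪))
          (fun i => ((maximalIdeal (Localization.AtPrime 𝔪)).toCotangent ⟨_, hU i⟩ :
            CotangentSpace (Localization.AtPrime 𝔪)))) ∧
      ∀ (𝔮 : Ideal A) [𝔮.IsPrime], h ∉ 𝔮 → ringKrullDim (Localization.AtPrime 𝔮) ≤ (3 : ℕ) →
        ((∀ i, U i ∈ 𝔮) ↔
          (algebraMap A (Localization.AtPrime 𝔮) F ∈ (maximalIdeal (Localization.AtPrime 𝔮)) ^ 2 ∧
            iotaFlatT (Localization.AtPrime 𝔮) (algebraMap A (Localization.AtPrime 𝔮) F) =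
              iotaFlatT (Localization.AtPrime 𝔪) (algebraMap A (Localization.AtPrime 𝔪) F))) ∧
        ((∀ i, U i ∈ 𝔮) → ∀ m : ℕ,
          jFlatT (Localization.AtPrime 𝔮) (algebraMap A (Localization.AtPrime 𝔮) F) m =
            (weightedMonomialIdeal U W m).map (algebraMap A (Localization.AtPrime 𝔮))) := by
  obtain ⟨h, hh, N, U, W, hW, hU, H⟩ := h
  exact ⟨h, hh, N, U, W, hW, hU, fun 𝔮 _ hh𝔮 hdim𝔮 => H 𝔮 hh𝔮 (by exact_mod_cast hdim𝔮)⟩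

/-- Scaling a family in `𝔪` by units keeps the differentials independent. [folklore] -/
theorem linearIndependent_toCotangent_mul_units {S : Type} [CommRing S] [IsLocalRing S] {N : ℕ} {u : Fin N → S}
    (hu : ∀ i, u i ∈ maximalIdeal S)
    (hli : LinearIndependent (ResidueField S) fun i => (maximalIdeal S).toCotangent ⟨u i, hu i⟩)
    (s : Fin N → S) (hs : ∀ i, IsUnit (s i)) (hus : ∀ i, u i * s i ∈ maximalIdeal S) :
    LinearIndependent (ResidueField S) fun i => (maximalIdeal S).toCotangent ⟨u i * s i, hus i⟩ := by
  classical
  rw [linearIndependent_toCotangent_iff_forall_mem] at hli ⊢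
  intro c hc i
  have h := hli (fun j => c j * s j) (by
    have heq : ∑ j, (c j * s j) * u j = ∑ j, c j * (u j * s j) := Finset.sum_congr rfl fun j _ => by ring
    rw [heq]; exact hc) i
  exact (Ideal.unit_mul_mem_iff_mem _ (hs i)).mp (by rw [mul_comm]; exact h)

/-- **The ORDER form of the regime off the point positions**: at a regular local position of dimension `≤ 3` which is not a
tie position and not a crossing position (`ε = 0`), the top `(ν ; ε ; τ)`-stratum is the equimultiple locus (res-type-073's
`topStratum_iotaOrdEps_eq_topStratum_iotaOrd_of_iotaEps_eq_zero`, res-type-013's (strat-τ)). [OURS · (o52-asm)] -/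
theorem topStratum_iotaOrdEpsTau_eq_topStratum_iotaOrd {S : Type} [CommRing S] [IsRegularLocalRing S]
    (hdim : ringKrullDim S ≤ 3) {f : S} (hf : f ∈ maximalIdeal S) (hτ : ¬ IsTiePosition S f) (hε : iotaEps S f = 0) :
    topStratum iotaOrdEpsTau S f = topStratum iotaOrd S f := by
  rw [topStratum_iotaOrdEpsTau_eq_topStratum_iotaOrdEps hdim hτ, topStratum_iotaOrdEps_eq_topStratum_iotaOrd_of_iotaEps_eq_zero hf hε]



/-! ## The height-two regime from a presenting pair (the `c = 2` branch of the assembly) -/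

/-- `dim S ≤ 2` when the maximal ideal of the regular local ring `S` is generated by two elements. [cite: Matsumura1987, Thm. 14.2] -/
theorem ringKrullDim_le_two_of_span_pair_eq_maximalIdeal (S : Type) [CommRing S] [IsRegularLocalRing S] {a b : S}
    (h : Ideal.span {a, b} = maximalIdeal S) : ringKrullDim S ≤ 2 := by
  have h2 : (maximalIdeal S).spanFinrank ≤ 2 := by
    rw [← h]
    refine (Submodule.spanFinrank_span_le_ncard_of_finite (Set.toFinite _)).trans ?_
    exact (Set.ncard_insert_le a {b}).trans (by rw [Set.ncard_singleton])
  rw [← IsRegularLocalRing.spanFinrank_maximalIdeal]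
  exact_mod_cast h2

/-- **THE HEIGHT-TWO REGIME OF (open″)≤3 FROM A PRESENTING PAIR.**  At a model position `(A, 𝔪, F)` (`S = A_𝔪` regular of
dimension `≤ 3`, `0 ≠ f = F/1 ∈ 𝔪_S²`) whose top `(ν ; ε ; τ)`-stratum prime is generated by a pair `(x₀, g₀)` with independent
differentials, and whose quotient `S ⧸ (x₀, g₀)` has the valuation dichotomy (a field or a discrete valuation ring), the input (T)
gives the literal ∃-body of `JOpenPresentationForallSingLE 3 p iotaFlatT jFlatT` at `(A, 𝔪, F)`: LEMMA M (res-L1-w43-stub-3) ⇒ `f`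
not of monomial type at `S_{(x₀,g₀)}`; res-D-brk-1's MAXIMISER DESCENT core `Descent.exists_pair_reaches` ⇒ a maximiser pair in `S`;
numerators in `A`; transport along `A_𝔭 ≃ (A_𝔪)_{(x₀,g₀)}` (`𝔭 = (x₀, g₀) ∩ A`); the ORDER form of the regime (not a tie, not a
crossing position: `𝔪_S` is not 2-generated unless `dim S ≤ 2`); then `jOpenPresentationLE_body_curve` (p552753).
[OURS · L1 W4.3 · (o52-asm)] -/
theorem jOpenBody_of_pair (p : ℕ)
    (hT : ∀ (k₀ : Type) [Field k₀] [CharP k₀ p] [PerfectField k₀]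
      (A : Type) [CommRing A] [Algebra k₀ A] [Algebra.FiniteType k₀ A] (𝔪 : Ideal A) [𝔪.IsPrime] (F : A)
      (𝔭 : Ideal A) [𝔭.IsPrime], 𝔭 ≤ 𝔪 →
      IsRegularLocalRing (Localization.AtPrime 𝔪) →
      ringKrullDim (Localization.AtPrime 𝔪) ≤ (3 : ℕ) →
      algebraMap A (Localization.AtPrime 𝔪) F ≠ 0 →
      algebraMap A (Localization.AtPrime 𝔪) F ∈ (maximalIdeal (Localization.AtPrime 𝔪)) ^ 2 →
      ringKrullDim (Localization.AtPrime 𝔭) = (2 : ℕ) →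
      topStratum iotaOrd (Localization.AtPrime 𝔪) (algebraMap A (Localization.AtPrime 𝔪) F) =
        {𝔮 | 𝔭.map (algebraMap A (Localization.AtPrime 𝔪)) ≤ 𝔮.asIdeal} →
      ¬ IsTiePosition (Localization.AtPrime 𝔪) (algebraMap A (Localization.AtPrime 𝔪) F) →
      ∃ h : A, h ∉ 𝔪 ∧ ∀ (𝔮 : Ideal A) [𝔮.IsPrime], h ∉ 𝔮 → 𝔭 ≤ 𝔮 → ringKrullDim (Localization.AtPrime 𝔮) ≤ (3 : ℕ) →
        ¬ IsTiePosition (Localization.AtPrime 𝔮) (algebraMap A (Localization.AtPrime 𝔮) F))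
    (k₀ : Type) [Field k₀] [CharP k₀ p] [PerfectField k₀] (A : Type) [CommRing A] [Algebra k₀ A] [Algebra.FiniteType k₀ A]
    (𝔪 : Ideal A) [𝔪.IsPrime] (hreg : IsRegularLocalRing (Localization.AtPrime 𝔪))
    (hdim : ringKrullDim (Localization.AtPrime 𝔪) ≤ (3 : ℕ)) (F : A)
    (hF0 : algebraMap A (Localization.AtPrime 𝔪) F ≠ 0)
    (hF2 : algebraMap A (Localization.AtPrime 𝔪) F ∈ (maximalIdeal (Localization.AtPrime 𝔪)) ^ 2)
    (x₀ g₀ : Localization.AtPrime 𝔪)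
    (hxg : ∀ i, (![x₀, g₀] : Fin 2 → Localization.AtPrime 𝔪) i ∈ maximalIdeal (Localization.AtPrime 𝔪))
    (hli2 : LinearIndependent (ResidueField (Localization.AtPrime 𝔪))
      (fun i => (maximalIdeal (Localization.AtPrime 𝔪)).toCotangent ⟨(![x₀, g₀] : Fin 2 → _) i, hxg i⟩))
    (hspan : Ideal.span {x₀, g₀} =
      topStratumPrime iotaOrdEpsTau (Localization.AtPrime 𝔪) (algebraMap A (Localization.AtPrime 𝔪) F))
    (hval : ∀ a b : Localization.AtPrime 𝔪, b ∉ Ideal.span {x₀, g₀} →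
      ∃ c : Localization.AtPrime 𝔪, a - b * c ∈ Ideal.span {x₀, g₀} ∨
        (c ∈ maximalIdeal (Localization.AtPrime 𝔪) ∧ b - a * c ∈ Ideal.span {x₀, g₀})) :
    ∃ h : A, h ∉ 𝔪 ∧ ∃ (N : ℕ) (U : Fin N → A) (W : Fin N → ℕ), (∀ i, 0 < W i) ∧
      (∃ hU : ∀ i, algebraMap A (Localization.AtPrime 𝔪) (U i) ∈ maximalIdeal (Localization.AtPrime 𝔪),
        LinearIndependent (ResidueField (Localization.AtPrime 𝔪))
          (fun i => ((maximalIdeal (Localization.AtPrime 𝔪)).toCotangent ⟨_, hU i⟩ :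
            CotangentSpace (Localization.AtPrime 𝔪)))) ∧
      ∀ (𝔮 : Ideal A) [𝔮.IsPrime], h ∉ 𝔮 → ringKrullDim (Localization.AtPrime 𝔮) ≤ (3 : ℕ) →
        ((∀ i, U i ∈ 𝔮) ↔
          (algebraMap A (Localization.AtPrime 𝔮) F ∈ (maximalIdeal (Localization.AtPrime 𝔮)) ^ 2 ∧
            iotaFlatT (Localization.AtPrime 𝔮) (algebraMap A (Localization.AtPrime 𝔮) F) =
              iotaFlatT (Localization.AtPrime 𝔪) (algebraMap A (Localization.AtPrime 𝔪) F))) ∧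
        ((∀ i, U i ∈ 𝔮) → ∀ m : ℕ,
          jFlatT (Localization.AtPrime 𝔮) (algebraMap A (Localization.AtPrime 𝔮) F) m =
            (weightedMonomialIdeal U W m).map (algebraMap A (Localization.AtPrime 𝔮))) := by
  classical
  haveI := hreg
  haveI : IsNoetherianRing A := Algebra.FiniteType.isNoetherianRing k₀ A
  haveI := isDomain_of_isRegularLocalRing (Localization.AtPrime 𝔪)
  have hdim3 : ringKrullDim (Localization.AtPrime 𝔪) ≤ 3 := by exact_mod_cast hdim
  have hf : algebraMap A (Localization.AtPrime 𝔪) F ∈ maximalIdeal (Localization.AtPrime 𝔪) := Ideal.pow_le_self two_ne_zero hF2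
  obtain ⟨-, hfν, hfν1⟩ := EssSmoothLevels.adicOrder_toNat_spec hF0 hf
  have hν : iotaOrd (Localization.AtPrime 𝔪) (algebraMap A (Localization.AtPrime 𝔪) F) =
      ((adicOrder (algebraMap A (Localization.AtPrime 𝔪) F)).toNat : ℕ) := (iotaOrd_eq_natCast_iff _ _ _).mpr ⟨hfν, hfν1⟩
  obtain ⟨hP₀, hregq, hfP₀, hE, hkept, -⟩ := topStratumPrime_iotaOrdEpsTau_spec hdim3 hF0 hf hν
  set P₀ := topStratumPrime iotaOrdEpsTau (Localization.AtPrime 𝔪) (algebraMap A (Localization.AtPrime 𝔪) F) with hP₀def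
  haveI := hP₀
  haveI hPpr : (Ideal.span {x₀, g₀}).IsPrime := by rw [hspan]; exact hP₀
  haveI : IsRegularLocalRing (Localization.AtPrime (Ideal.span {x₀, g₀})) :=
    isRegularLocalRing_localization_atPrime (Localization.AtPrime 𝔪) _
  haveI := isDomain_of_isRegularLocalRing (Localization.AtPrime (Ideal.span {x₀, g₀}))
  have hordP₀ : iotaOrd (Localization.AtPrime P₀) (algebraMap (Localization.AtPrime 𝔪) (Localization.AtPrime P₀)
      (algebraMap A (Localization.AtPrime 𝔪) F)) = iotaOrd (Localization.AtPrime 𝔪) (algebraMap A (Localization.AtPrime 𝔪) F) := by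
    have h := (hkept P₀ hfP₀).mpr le_rfl
    rw [iotaOrdEpsTau_eq_iff, iotaOrdEps_eq_iff] at h
    exact h.1.1
  -- not of monomial type at `S_P` (LEMMA M), `f/1 ≠ 0`, the order is kept, equimultiplicity
  have hnm := JFlatEssSmooth.not_isMonomialType_of_topStratumPrime_eq hdim3 hF0 hf (x₀) (g₀) hxg hli2 hspan.symm
  have hfP : algebraMap A (Localization.AtPrime 𝔪) F ∈ Ideal.span {x₀, g₀} := by rw [hspan]; exact hfP₀
  have hf0P : algebraMap (Localization.AtPrime 𝔪) (Localization.AtPrime (Ideal.span {x₀, g₀}))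
      (algebraMap A (Localization.AtPrime 𝔪) F) ≠ 0 := fun h =>
    hF0 (IsLocalization.injective (Localization.AtPrime (Ideal.span {x₀, g₀}))
      (Ideal.primeCompl_le_nonZeroDivisors (Ideal.span {x₀, g₀})) (by rw [h, map_zero]))
  have hordP : iotaOrd (Localization.AtPrime (Ideal.span {x₀, g₀}))
      (algebraMap (Localization.AtPrime 𝔪) (Localization.AtPrime (Ideal.span {x₀, g₀})) (algebraMap A (Localization.AtPrime 𝔪) F)) =
      ((adicOrder (algebraMap A (Localization.AtPrime 𝔪) F)).toNat : ℕ) := by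
    rw [← hν, StratumIff.iota_localization_congr iotaOrd hspan, hordP₀]
  have hfmP : algebraMap (Localization.AtPrime 𝔪) (Localization.AtPrime (Ideal.span {x₀, g₀}))
      (algebraMap A (Localization.AtPrime 𝔪) F) ∈ maximalIdeal (Localization.AtPrime (Ideal.span {x₀, g₀})) :=
    (IsLocalization.AtPrime.to_map_mem_maximal_iff (Localization.AtPrime (Ideal.span {x₀, g₀})) (Ideal.span {x₀, g₀}) _).mpr hfP
  obtain ⟨-, h1P, h2P⟩ := EssSmoothLevels.adicOrder_toNat_spec hf0P hfmP
  have hordeq : (adicOrder (algebraMap (Localization.AtPrime 𝔪) (Localization.AtPrime (Ideal.span {x₀, g₀}))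
      (algebraMap A (Localization.AtPrime 𝔪) F))).toNat = (adicOrder (algebraMap A (Localization.AtPrime 𝔪) F)).toNat := by
    have hordP' := (iotaOrd_eq_natCast_iff _ _ _).mpr ⟨h1P, h2P⟩
    rw [hordP, Nat.cast_inj] at hordP'
    exact hordP'.symm
  have heq : algebraMap A (Localization.AtPrime 𝔪) F ∉ maximalIdeal (Localization.AtPrime 𝔪) ^
      ((adicOrder (algebraMap (Localization.AtPrime 𝔪) (Localization.AtPrime (Ideal.span {x₀, g₀}))
        (algebraMap A (Localization.AtPrime 𝔪) F))).toNat + 1) := by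
    rw [hordeq]; exact hfν1
  -- the maximiser pair `(x', g')` in `S` (MAXIMISER DESCENT)
  obtain ⟨hmaxP, hg₀2, -, -⟩ := Descent.pair_facts (Ideal.span {x₀, g₀}) hxg hli2 rfl
  have hf2P := mem_sq_of_not_isMonomialType hf0P hnm ⟨_, hmaxP ▸ Ideal.subset_span (by simp), hg₀2⟩
  obtain ⟨hb, hreach⟩ := one_le_bMax_and_reaches_of_essFiniteType k₀ (Localization.AtPrime (Ideal.span {x₀, g₀})) hf0P hf2P hnm
  obtain ⟨x', g', hspan', hxg', hli', hreach'⟩ :=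
    Descent.exists_pair_reaches (Ideal.span {x₀, g₀}) hval hxg hli2 rfl hf0P hnm heq hb hreach
  -- numerators `x, g ∈ A`
  obtain ⟨⟨x, sx⟩, hx⟩ := IsLocalization.surj 𝔪.primeCompl x'
  obtain ⟨⟨g, sg⟩, hgg⟩ := IsLocalization.surj 𝔪.primeCompl g'
  simp only at hx hgg
  have hsxu : IsUnit (algebraMap A (Localization.AtPrime 𝔪) (sx : A)) := IsLocalization.map_units _ sx
  have hsgu : IsUnit (algebraMap A (Localization.AtPrime 𝔪) (sg : A)) := IsLocalization.map_units _ sg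
  -- `(x/1, g/1) = (x', g')` as ideals, with independent differentials
  have hspanxg : Ideal.span {algebraMap A (Localization.AtPrime 𝔪) x, algebraMap A (Localization.AtPrime 𝔪) g} =
      Ideal.span {x', g'} := by
    rw [← hx, ← hgg]
    simp only [Ideal.span_insert, Ideal.span_singleton_mul_right_unit hsxu, Ideal.span_singleton_mul_right_unit hsgu]
  have hU𝔪 : ∀ i, algebraMap A (Localization.AtPrime 𝔪) ((![x, g] : Fin 2 → A) i) ∈ maximalIdeal (Localization.AtPrime 𝔪) := by
    intro i; fin_cases i
    · show algebraMap A _ x ∈ _; rw [← hx]; exact Ideal.mul_mem_right _ _ (hxg' 0)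
    · show algebraMap A _ g ∈ _; rw [← hgg]; exact Ideal.mul_mem_right _ _ (hxg' 1)
  have hli𝔪 : LinearIndependent (ResidueField (Localization.AtPrime 𝔪)) fun i =>
      (maximalIdeal (Localization.AtPrime 𝔪)).toCotangent ⟨algebraMap A _ ((![x, g] : Fin 2 → A) i), hU𝔪 i⟩ := by
    have h := linearIndependent_toCotangent_mul_units hxg' hli' ![algebraMap A _ (sx : A), algebraMap A _ (sg : A)]
      (fun i => by fin_cases i <;> assumption) (fun i => by
        fin_cases i
        · show x' * algebraMap A _ (sx : A) ∈ _; rw [hx]; exact hU𝔪 0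
        · show g' * algebraMap A _ (sg : A) ∈ _; rw [hgg]; exact hU𝔪 1)
    convert h using 1
    funext i; fin_cases i
    · show _ = (maximalIdeal _).toCotangent ⟨x' * algebraMap A _ (sx : A), _⟩
      congr 1; exact Subtype.ext hx.symm
    · show _ = (maximalIdeal _).toCotangent ⟨g' * algebraMap A _ (sg : A), _⟩
      congr 1; exact Subtype.ext hgg.symm
  -- the prime `𝔭 = P ∩ A`
  set 𝔭 : Ideal A := (Ideal.span {x₀, g₀}).comap (algebraMap A (Localization.AtPrime 𝔪)) with h𝔭
  haveI : 𝔭.IsPrime := Ideal.IsPrime.comap _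
  have h𝔭𝔪 : 𝔭 ≤ 𝔪 := by
    intro a ha
    by_contra ha𝔪
    have hau : IsUnit (algebraMap A (Localization.AtPrime 𝔪) a) := IsLocalization.map_units _ (⟨a, ha𝔪⟩ : 𝔪.primeCompl)
    exact hPpr.ne_top (Ideal.eq_top_of_isUnit_mem _ (Ideal.mem_comap.mp ha) hau)
  have h𝔭map : 𝔭.map (algebraMap A (Localization.AtPrime 𝔪)) = Ideal.span {x₀, g₀} := by
    rw [h𝔭, ← Ideal.under_def]; exact IsLocalization.map_under 𝔪.primeCompl (Localization.AtPrime 𝔪) _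
  have hxg𝔪 : (Ideal.span {x, g}).map (algebraMap A (Localization.AtPrime 𝔪)) = 𝔭.map (algebraMap A (Localization.AtPrime 𝔪)) := by
    rw [Ideal.map_span, Set.image_pair, hspanxg, hspan', h𝔭map]
  -- `A_𝔭 ≃ S_P` over `A`
  haveI := isPrime_map_atPrime_of_le 𝔭 𝔪 h𝔭𝔪
  let e₁ : Localization.AtPrime 𝔭 ≃+* Localization.AtPrime (Ideal.span {x₀, g₀}) :=
    (IsLocalization.localizationLocalizationAtPrimeIsoLocalization 𝔪.primeCompl (Ideal.span {x₀, g₀})).toRingEquiv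
  have he₁ : ∀ a : A, e₁ (algebraMap A (Localization.AtPrime 𝔭) a) =
      algebraMap (Localization.AtPrime 𝔪) (Localization.AtPrime (Ideal.span {x₀, g₀})) (algebraMap A (Localization.AtPrime 𝔪) a) := by
    intro a
    rw [← IsScalarTower.algebraMap_apply A (Localization.AtPrime 𝔪) (Localization.AtPrime (Ideal.span {x₀, g₀})) a]
    exact (IsLocalization.localizationLocalizationAtPrimeIsoLocalization 𝔪.primeCompl (Ideal.span {x₀, g₀})).commutes a
  haveI h𝔭reg : IsRegularLocalRing (Localization.AtPrime 𝔭) := IsRegularLocalRing.of_ringEquiv e₁.symm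
  -- `dim A_𝔭 = 2`
  have hdimP : ringKrullDim (Localization.AtPrime (Ideal.span {x₀, g₀})) = 2 :=
    LocalGameEFT4SDimLETwo.ringKrullDim_eq_two_of_not_isMonomialType _ (ringKrullDim_atPrime_span_pair_le_two _ _) hf0P hfmP hnm
  have hdim𝔭 : ringKrullDim (Localization.AtPrime 𝔭) = 2 := by rw [RingEquiv.ringKrullDim e₁]; exact hdimP
  -- `F`, `g` read in `A_𝔭`
  have hFe : e₁ (algebraMap A (Localization.AtPrime 𝔭) F) =
      algebraMap (Localization.AtPrime 𝔪) (Localization.AtPrime (Ideal.span {x₀, g₀})) (algebraMap A (Localization.AtPrime 𝔪) F) :=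
    he₁ F
  have hge : e₁ (algebraMap A (Localization.AtPrime 𝔭) g) =
      algebraMap (Localization.AtPrime 𝔪) (Localization.AtPrime (Ideal.span {x₀, g₀})) (algebraMap A (Localization.AtPrime 𝔪) (sg : A)) *
        algebraMap (Localization.AtPrime 𝔪) (Localization.AtPrime (Ideal.span {x₀, g₀})) g' := by
    rw [he₁ g, ← hgg, map_mul, mul_comm]
  have hsgu' : IsUnit (algebraMap (Localization.AtPrime 𝔪) (Localization.AtPrime (Ideal.span {x₀, g₀}))
      (algebraMap A (Localization.AtPrime 𝔪) (sg : A))) := hsgu.map _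
  have hF0T : algebraMap A (Localization.AtPrime 𝔭) F ≠ 0 := fun h => hf0P (by rw [← hFe, h, map_zero])
  have hnmT : ¬ IsMonomialType (algebraMap A (Localization.AtPrime 𝔭) F) := by
    rw [← isMonomialType_ringEquiv_iff e₁, hFe]; exact hnm
  have hreachT : algebraMap A (Localization.AtPrime 𝔭) F ∈
      contactFiltration (algebraMap A (Localization.AtPrime 𝔭) g) (bMax (algebraMap A (Localization.AtPrime 𝔭) F))
        (bMax (algebraMap A (Localization.AtPrime 𝔭) F) * (adicOrder (algebraMap A (Localization.AtPrime 𝔭) F)).toNat) := by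
    rw [← apply_mem_contactFiltration_iff e₁, ← bMax_ringEquiv e₁ (algebraMap A (Localization.AtPrime 𝔭) F),
      ← adicOrder_map_ringEquiv e₁ (algebraMap A (Localization.AtPrime 𝔭) F), hFe, hge, contactFiltration_unit_mul hsgu']
    exact hreach'
  -- `(x, g) A_𝔭 = 𝔪_{A_𝔭}`
  have hxg𝔭 : (Ideal.span {x, g}).map (algebraMap A (Localization.AtPrime 𝔭)) = maximalIdeal (Localization.AtPrime 𝔭) := by
    have hcomp : (e₁ : Localization.AtPrime 𝔭 →+* Localization.AtPrime (Ideal.span {x₀, g₀})).comp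
        (algebraMap A (Localization.AtPrime 𝔭)) =
        (algebraMap (Localization.AtPrime 𝔪) (Localization.AtPrime (Ideal.span {x₀, g₀}))).comp
          (algebraMap A (Localization.AtPrime 𝔪)) :=
      RingHom.ext fun a => he₁ a
    have key : ((Ideal.span {x, g}).map (algebraMap A (Localization.AtPrime 𝔭))).map
        (e₁ : Localization.AtPrime 𝔭 →+* Localization.AtPrime (Ideal.span {x₀, g₀})) =
        (maximalIdeal (Localization.AtPrime 𝔭)).map
          (e₁ : Localization.AtPrime 𝔭 →+* Localization.AtPrime (Ideal.span {x₀, g₀})) := by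
      rw [Ideal.map_map, hcomp, ← Ideal.map_map, hxg𝔪, h𝔭map, Localization.AtPrime.map_eq_maximalIdeal, Ideal.map_coe,
        IsLocalRing.map_ringEquiv_maximalIdeal e₁]
    have h := congr_arg (Ideal.map (e₁.symm : Localization.AtPrime (Ideal.span {x₀, g₀}) →+* Localization.AtPrime 𝔭)) key
    rwa [Ideal.map_of_equiv, Ideal.map_of_equiv] at h
  -- the regime in ORDER form: not a tie, not a crossing position
  have hnotie : ¬ IsTiePosition (Localization.AtPrime 𝔪) (algebraMap A (Localization.AtPrime 𝔪) F) := by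
    intro htie
    have hP𝔪 : P₀ = maximalIdeal (Localization.AtPrime 𝔪) := topStratumPrime_iotaOrdEpsTau_eq_maximalIdeal_of_isTiePosition htie
    have h3 : ringKrullDim (Localization.AtPrime 𝔪) = 3 := ringKrullDim_eq_three_of_isTiePosition htie
    have hle2 := ringKrullDim_le_two_of_span_pair_eq_maximalIdeal (Localization.AtPrime 𝔪) (hspan.trans hP𝔪)
    rw [h3] at hle2
    exact absurd hle2 (by decide)
  have hε0 : iotaEps (Localization.AtPrime 𝔪) (algebraMap A (Localization.AtPrime 𝔪) F) = 0 := by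
    rcases iotaEps_eq_zero_or_eq_one (Localization.AtPrime 𝔪) (algebraMap A (Localization.AtPrime 𝔪) F) with h0 | h1
    · exact h0
    · exfalso
      have hpt := isPointCentrePosition_of_isCrossingPosition hdim3 hF0 hf h1
      have hP𝔪 : P₀ = maximalIdeal (Localization.AtPrime 𝔪) := by
        rw [hP₀def, topStratumPrime_iotaOrdEpsTau_eq_of_not_isTiePosition hdim3 hnotie]; exact hpt
      have hle2 := ringKrullDim_le_two_of_span_pair_eq_maximalIdeal (Localization.AtPrime 𝔪) (hspan.trans hP𝔪)
      have := iotaEps_eq_zero_of_ringKrullDim_le_two hle2 hF0 hf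
      rw [h1] at this
      exact one_ne_zero this
  have hEord : topStratum iotaOrd (Localization.AtPrime 𝔪) (algebraMap A (Localization.AtPrime 𝔪) F) =
      {𝔮 | 𝔭.map (algebraMap A (Localization.AtPrime 𝔪)) ≤ 𝔮.asIdeal} := by
    rw [← topStratum_iotaOrdEpsTau_eq_topStratum_iotaOrd hdim3 hf hnotie hε0, hE, h𝔭map, hspan]
  -- (T): tie-freeness along `V(𝔭)` near `𝔪`
  obtain ⟨hτ₀, hhτ₀, hτ⟩ := hT k₀ A 𝔪 F 𝔭 h𝔭𝔪 hreg hdim hF0 hF2 (by rw [hdim𝔭]; norm_cast) hEord hnotie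
  -- the CURVE body
  exact jOpenBodyLE3_of_three 𝔪 F (jOpenPresentationLE_body_curve k₀ A 𝔪 hdim3 F 𝔭 h𝔭𝔪 hdim𝔭 x g hxg𝔭 hxg𝔪 hU𝔪 hli𝔪
    hF0T hnmT hreachT hEord hhτ₀ (fun 𝔮 _ hh𝔮 h𝔭𝔮 hdim𝔮 => hτ 𝔮 hh𝔮 h𝔭𝔮 (by exact_mod_cast hdim𝔮)))

end JOpenLE3

end Summit.ResolutionOfSingularities.ResolutionOfSingularities.Theorems

end
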